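import Literature.NumberTheory.ComplexMultiplication.CMTypeUniformizationHoms
import Literature.NumberTheory.ComplexMultiplication.MainTheoremOfComplexMultiplication
import HarnessLib

/-!
# Main theorem of complex multiplication — clause (2) at level `N`: transport along the TT-idèle and the torsion reindex

[Shimura1998] G. Shimura, *Abelian varieties with complex multiplication and modular functions*, Princeton 1998,
§18.6, proof of Thm. 18.6, pp. 127–129 (the step «for `u ∈ N⁻¹𝔞/𝔞` … `ξ(u)^σ = ξ′(g(s)⁻¹u)`», (∗∗∗) p. 129; the held text's
chunk ids p0167–p0169 are not pages).

Topic: the TORSION BOOKKEEPING HALF of the level-`N` structure (row II-1 S7a of the h21 programme, junction predicate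
`IsLevelUniformization`, clause (2)_N): theorems only, no definition, no named fact.  Everything geometric is abstracted
into a map `F : A(ℂ) → A′(ℂ)` (in the application `F = conjPoints σ`, «`x ↦ x^σ`») and a second uniformisation `ξ₂` of
`A′` of type `(K, Φ; 𝔠)` through which `F ∘ ξ` factors ON `N`-TORSION as an `S(b)` («`ξ(u)^σ = λ(ξ(u)) = ξ₂(bu)` for
`u ∈ N⁻¹𝔞`», the congruence-relation step: `σ` acts on `A[N]` as the Frobenius lift `λ`, and `λ ∘ ξ = ξ₂ ∘ S(b)` by
[Shimura1998, §7.4 Prop. 15]); everything idèlic is abstracted into a finite idèle `t` (in the application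
`t = g(s)_𝐡⁻¹`) and an element `g ∈ K^×` (in the application `g = g(d₀)`, the reflex norm of the TT-idèle's `d₀`) with
the TORSION CONGRUENCE «`t · (u mod 𝔞) = g u (mod t𝔞)` for `u ∈ N⁻¹𝔞`» (clause 2 of the tree's
`exists_reflexNorm_torsionCongruence_of_abRestrict_ideleArtinMap_eq_galFrob`) and the LATTICE IDENTITY `t𝔞 = (g b⁻¹)𝔠`
(clause 3 there, combined with the lattice of `λ`).  CONCLUSION: the reindexed uniformisation `ξ′ := ξ₂ ∘ S((g b⁻¹)⁻¹)` of
type `(K, Φ; t𝔞)` satisfies clause (2) of Thm. 18.6 at level `N` in the junction's exact form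
«`N u ∈ 𝔞 → t · (u mod 𝔞) = (v mod t𝔞) → F(ξ(u)) = ξ′(v)`», together with the two reindex formulas the polarisation
step needs.

## Main statements
* `CMTypeUniformization.r_eq_r_of_sub_mem` — `v − w ∈ 𝔞 ⇒ ξ(v) = ξ(w)`.
* `CMTypeUniformization.forall_conj_eq_of_eq_on_torsion` — «`F = G` on `A[N](ℂ)`» + «`G ∘ ξ = ξ₂ ∘ S(b)`» ⇒ the
  factorisation hypothesis `hF` of the main theorem.
* `CMTypeUniformization.exists_reindex_forall_conj_eq_of_torsionCongruence` — THE (2)_N TRANSPORT (above).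
* `CMTypeUniformization.exists_reindex_forall_conj_eq_of_torsionCongruence_units` — the same with the lattice packaged as
  the junction's `ideleMulIdealUnits t 𝔞`.
-/

noncomputable section

open CategoryTheory NumberField IsDedekindDomain
open scoped NumberField nonZeroDivisors

namespace Literature.NumberTheory.ComplexMultiplication

open Literature.AlgebraicGeometry.Motives (CMType AbelianVariety AlgPoints)
open Literature.NumberTheory.NumberFields
open FractionalIdeal (spanSingleton)

namespace CMTypeUniformization

variable {K : Type} [Field K] [NumberField K] {k : Type} [Field k] [Algebra k ℂ]
  {Φ : CMType K} {𝔞 𝔟 𝔠 : (FractionalIdeal (𝓞 K)⁰ K)ˣ} {A A' : AbelianVariety k}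
  {ι : 𝓞 K →+* End A} {ι' : 𝓞 K →+* End A'}

/-- `ξ` only depends on `u mod 𝔞`: `v − w ∈ 𝔞 ⇒ ξ(v) = ξ(w)` («`ξ` gives an isomorphism of `K/𝔞` onto the points of
finite order»). [cite: Shimura1998, §18.4 (18.4a) p. 123; §18.6 Thm. 18.6 (2), p. 125] -/
theorem r_eq_r_of_sub_mem (ξ : CMTypeUniformization Φ 𝔞 A ι) {v w : K}
    (h : v - w ∈ (𝔞 : FractionalIdeal (𝓞 K)⁰ K)) : ξ.r v = ξ.r w := by
  have h1 : ξ.r (v - w) = 1 := (ξ.r_eq_one_iff (v - w)).mpr h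
  have h2 : ξ.r v = ξ.r (v - w) * ξ.r w := by rw [← ξ.r_add, sub_add_cancel]
  rw [h2, h1, one_mul]

/-- `ξ` only depends on `u mod 𝔞`, quotient form: `(v mod 𝔞) = (w mod 𝔞)` in `K/𝔞` ⇒ `ξ(v) = ξ(w)`.
[cite: Shimura1998, §18.4 (18.4a) p. 123; §18.6 Thm. 18.6 (2), p. 125] -/
theorem r_eq_r_of_mk_eq_mk (ξ : CMTypeUniformization Φ 𝔞 A ι) {v w : K}
    (h : (Submodule.Quotient.mk v : K ⧸ ((𝔞 : FractionalIdeal (𝓞 K)⁰ K) : Submodule (𝓞 K) K)) =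
      Submodule.Quotient.mk w) : ξ.r v = ξ.r w :=
  ξ.r_eq_r_of_sub_mem ((FractionalIdeal.mem_coe).mp ((Submodule.Quotient.eq _).mp h))

/-- **The factorisation hypothesis from the congruence relation**: if `F` and `G` agree on `A[N](ℂ)` (in the application:
«`x^σ = λ(x)` for `x ∈ A[N]`», `σ` acting on prime-to-`𝔓` torsion as the Frobenius lift `λ`) and `G ∘ ξ = ξ₂ ∘ S(b)`
(«`λ ∘ ξ = ξ₂ ∘ S(b)`», [Shimura1998, §7.4 Prop. 15]), then `F(ξ(u)) = ξ₂(bu)` for every `u ∈ N⁻¹𝔞`.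
[cite: Shimura1998, §18.6 proof of Thm. 18.6 (reduction modulo `𝔓`: «`t^σ = κt`» for the points `t`, `Mt = 0`), pp. 127–128] -/
theorem forall_conj_eq_of_eq_on_torsion (ξ : CMTypeUniformization Φ 𝔞 A ι) (ξ₂ : CMTypeUniformization Φ 𝔠 A' ι')
    (F G : A.Points ℂ → A'.Points ℂ) {N : ℕ} {b : K}
    (hFG : ∀ P : A.Points ℂ, P ∈ A.torsionPoints ℂ (N : ℤ) → F P = G P)
    (hG : ∀ u : K, G (ξ.r u) = ξ₂.r (b * u)) :
    ∀ u : K, (N : K) * u ∈ (𝔞 : FractionalIdeal (𝓞 K)⁰ K) → F (ξ.r u) = ξ₂.r (b * u) := fun u hu => by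
  rw [hFG (ξ.r u) (ξ.r_nsmul_mem N u hu), hG u]

/-- **Clause (2) of Thm. 18.6 at level `N`, transported along the TT-idèle and the torsion reindex.**  Data: `ξ` of type
`(K, Φ; 𝔞)` on `A`, `ξ₂` of type `(K, Φ; 𝔠)` on `A′`, a map `F : A(ℂ) → A′(ℂ)` with `F(ξ(u)) = ξ₂(bu)` for `u ∈ N⁻¹𝔞`
(`hF`, see `forall_conj_eq_of_eq_on_torsion`), a finite idèle `t` and `g ∈ K^×` with the torsion congruence
`t · (u mod 𝔞) = (g u mod t𝔞)` for `u ∈ N⁻¹𝔞` (`hTT`) and the lattice identity `t𝔞 = (g b⁻¹)𝔠` (`h𝔟`, `h𝔠`).  Then the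
reindexed `ξ′ := ξ₂ ∘ S((g b⁻¹)⁻¹)` of type `(K, Φ; t𝔞)` satisfies «`N u ∈ 𝔞 → t · (u mod 𝔞) = (v mod t𝔞) → F(ξ(u)) = ξ′(v)`»
and `ξ′((g b⁻¹) w) = ξ₂(w)`, `ξ′(w) = ξ₂((g b⁻¹)⁻¹ w)`.  (In the print: `F = σ`, `t = g(s)⁻¹`, `g = g(d₀)`, `b = 1` after
Shimura's normalisation of `λ`, and the conclusion is «`ξ(u)^σ = ξ′(v)` for `u ∈ N⁻¹𝔞/𝔞`», (∗∗∗) p. 129.)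
[cite: Shimura1998, §18.6 proof of Thm. 18.6 (reduction modulo `𝔓`, (∗∗)–(∗∗∗)), pp. 127–129] -/
theorem exists_reindex_forall_conj_eq_of_torsionCongruence (ξ : CMTypeUniformization Φ 𝔞 A ι)
    (ξ₂ : CMTypeUniformization Φ 𝔠 A' ι') (F : A.Points ℂ → A'.Points ℂ) (t : (FiniteAdeleRing (𝓞 K) K)ˣ)
    {N : ℕ} {b g : K} (hb : b ≠ 0) (hg : g ≠ 0)
    (hF : ∀ u : K, (N : K) * u ∈ (𝔞 : FractionalIdeal (𝓞 K)⁰ K) → F (ξ.r u) = ξ₂.r (b * u))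
    (hTT : ∀ u : K, (N : K) * u ∈ (𝔞 : FractionalIdeal (𝓞 K)⁰ K) →
      IdeleAction.ideleMulEquiv t (𝔞 : FractionalIdeal (𝓞 K)⁰ K) 𝔞.ne_zero (Submodule.Quotient.mk u) =
        Submodule.Quotient.mk (g * u))
    (h𝔟 : (𝔟 : FractionalIdeal (𝓞 K)⁰ K) = IdeleAction.ideleMulIdeal t (𝔞 : FractionalIdeal (𝓞 K)⁰ K))
    (h𝔠 : (𝔟 : FractionalIdeal (𝓞 K)⁰ K) = spanSingleton (𝓞 K)⁰ (g * b⁻¹) * (𝔠 : FractionalIdeal (𝓞 K)⁰ K)) :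
    ∃ ξ' : CMTypeUniformization Φ 𝔟 A' ι',
      (∀ u v : K, (N : K) * u ∈ (𝔞 : FractionalIdeal (𝓞 K)⁰ K) →
        IdeleAction.ideleMulEquiv t (𝔞 : FractionalIdeal (𝓞 K)⁰ K) 𝔞.ne_zero (Submodule.Quotient.mk u) =
          (Submodule.Quotient.mk v :
            K ⧸ ((IdeleAction.ideleMulIdeal t (𝔞 : FractionalIdeal (𝓞 K)⁰ K) : FractionalIdeal (𝓞 K)⁰ K) :
              Submodule (𝓞 K) K)) →
          F (ξ.r u) = ξ'.r v) ∧
      (∀ w : K, ξ'.r ((g * b⁻¹) * w) = ξ₂.r w) ∧ (∀ w : K, ξ'.r w = ξ₂.r ((g * b⁻¹)⁻¹ * w)) := by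
  have hgb : g * b⁻¹ ≠ 0 := mul_ne_zero hg (inv_ne_zero hb)
  obtain ⟨ξ', h1, h2⟩ := ξ₂.exists_reindex hgb h𝔠
  refine ⟨ξ', fun u v hu huv => ?_, h1, h2⟩
  -- `v ≡ g u (mod t𝔞)` from the torsion congruence
  have hmk : (Submodule.Quotient.mk v :
      K ⧸ ((IdeleAction.ideleMulIdeal t (𝔞 : FractionalIdeal (𝓞 K)⁰ K) : FractionalIdeal (𝓞 K)⁰ K) :
        Submodule (𝓞 K) K)) = Submodule.Quotient.mk (g * u) := by
    rw [← huv, hTT u hu]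
  have hsub : v - g * u ∈ (𝔟 : FractionalIdeal (𝓞 K)⁰ K) := by
    rw [h𝔟]
    exact (FractionalIdeal.mem_coe).mp ((Submodule.Quotient.eq _).mp hmk)
  rw [ξ'.r_eq_r_of_sub_mem hsub, hF u hu, ← h1 (b * u)]
  congr 1
  field_simp

/-- **Clause (2) at level `N` — the junction's packaging**: the same as
`exists_reindex_forall_conj_eq_of_torsionCongruence` with the target lattice given as the invertible fractional ideal
`ideleMulIdealUnits t 𝔞` (the index of `CMTypeUniformization` in `IsLevelUniformization`, where `t = g(s)_𝐡⁻¹`).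
[cite: Shimura1998, §18.6 proof of Thm. 18.6 (reduction modulo `𝔓`, (∗∗)–(∗∗∗)), pp. 127–129] -/
theorem exists_reindex_forall_conj_eq_of_torsionCongruence_units (ξ : CMTypeUniformization Φ 𝔞 A ι)
    (ξ₂ : CMTypeUniformization Φ 𝔠 A' ι') (F : A.Points ℂ → A'.Points ℂ) (t : (FiniteAdeleRing (𝓞 K) K)ˣ)
    {N : ℕ} {b g : K} (hb : b ≠ 0) (hg : g ≠ 0)
    (hF : ∀ u : K, (N : K) * u ∈ (𝔞 : FractionalIdeal (𝓞 K)⁰ K) → F (ξ.r u) = ξ₂.r (b * u))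
    (hTT : ∀ u : K, (N : K) * u ∈ (𝔞 : FractionalIdeal (𝓞 K)⁰ K) →
      IdeleAction.ideleMulEquiv t (𝔞 : FractionalIdeal (𝓞 K)⁰ K) 𝔞.ne_zero (Submodule.Quotient.mk u) =
        Submodule.Quotient.mk (g * u))
    (h𝔠 : IdeleAction.ideleMulIdeal t (𝔞 : FractionalIdeal (𝓞 K)⁰ K) =
      spanSingleton (𝓞 K)⁰ (g * b⁻¹) * (𝔠 : FractionalIdeal (𝓞 K)⁰ K)) :
    ∃ ξ' : CMTypeUniformization Φ (ideleMulIdealUnits t 𝔞) A' ι',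
      (∀ u v : K, (N : K) * u ∈ (𝔞 : FractionalIdeal (𝓞 K)⁰ K) →
        IdeleAction.ideleMulEquiv t (𝔞 : FractionalIdeal (𝓞 K)⁰ K) 𝔞.ne_zero (Submodule.Quotient.mk u) =
          Submodule.Quotient.mk v →
          F (ξ.r u) = ξ'.r v) ∧
      (∀ w : K, ξ'.r ((g * b⁻¹) * w) = ξ₂.r w) ∧ (∀ w : K, ξ'.r w = ξ₂.r ((g * b⁻¹)⁻¹ * w)) :=
  exists_reindex_forall_conj_eq_of_torsionCongruence ξ ξ₂ F t hb hg hF hTT (coe_ideleMulIdealUnits t 𝔞)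
    (by rw [coe_ideleMulIdealUnits, h𝔠])

/-! ## Appended: the S7a instantiation shape (G11a) — `b = 1`, lattice identity from TT clause 3 + the `𝔮`-bridge -/

/-- **Clause (2) at level `N` — the ASSEMBLY SHAPE (S7a piece G11a).**  Data as consumed by the level-structure harness:
`ξ` of type `(K, Φ; 𝔞)` on `A`; `η` of type `(K, Φ; 𝔠)` on `A′` — the uniformisation of the conjugate carrier obtained by
transporting the class representative's `η_i` along `θ : A_i ≅ A₀^γ` and the exchange/tower isomorphisms, so that the
`𝔮`-multiplication-then-`θ` homomorphism `κ` reads `G ∘ ξ = η` on points (`hG`, «`λ ∘ ξ = η_i`» with `b = 1`); `F` = `σ`-conjugation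
with `F = G` on `A[N](ℂ)` (`hFG`, «`x^σ = κx` on `N`-torsion», the congruence-relation step); the TT-idèle data: `t = g(s)_𝐡⁻¹`,
`g = g(d₀) ≠ 0`, the torsion congruence (`hTT`, TT clause 2) and the lattice identity `g(c)_𝐡⁻¹𝔞 = g⁻¹·t𝔞` (`h3`, TT clause 3
verbatim shape) with `𝔠 = g(c)_𝐡⁻¹𝔞 (= 𝔮⁻¹𝔞)` (`h𝔠`, the `𝔮`-bridge).  CONCLUSION: a uniformisation `ξ′` of `A′` of type
`(K, Φ; t𝔞)` (index `ideleMulIdealUnits t 𝔞`, the junction's) with clause (2)_N «`N u ∈ 𝔞 → t·(u mod 𝔞) = (v mod t𝔞) → F(ξ(u)) = ξ′(v)`»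
and the reindex formulas `ξ′(g w) = η(w)`, `ξ′(w) = η(g⁻¹ w)` (the `β = g⁻¹` bookkeeping of the polarisation clause).
[cite: Shimura1998, §18.6 proof of Thm. 18.6 ((∗∗∗) «r(w)^σ = r′(g(s)⁻¹w)»), pp. 128–129; p. 128 («𝔮⁻¹𝔞 = g(c)⁻¹𝔞 = g(d⁻¹)g(s⁻¹)𝔞»)] -/
theorem exists_reindex_forall_conj_eq_of_torsionCongruence_of_latticeIdentity (ξ : CMTypeUniformization Φ 𝔞 A ι)
    (η : CMTypeUniformization Φ 𝔠 A' ι') (F G : A.Points ℂ → A'.Points ℂ)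
    (t c : (FiniteAdeleRing (𝓞 K) K)ˣ) {N : ℕ} {g : K} (hg : g ≠ 0)
    (hFG : ∀ P : A.Points ℂ, P ∈ A.torsionPoints ℂ (N : ℤ) → F P = G P)
    (hG : ∀ u : K, G (ξ.r u) = η.r u)
    (hTT : ∀ u : K, (N : K) * u ∈ (𝔞 : FractionalIdeal (𝓞 K)⁰ K) →
      IdeleAction.ideleMulEquiv t (𝔞 : FractionalIdeal (𝓞 K)⁰ K) 𝔞.ne_zero (Submodule.Quotient.mk u) =
        Submodule.Quotient.mk (g * u))
    (h3 : IdeleAction.ideleMulIdeal c (𝔞 : FractionalIdeal (𝓞 K)⁰ K) =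
      spanSingleton (𝓞 K)⁰ g⁻¹ * IdeleAction.ideleMulIdeal t (𝔞 : FractionalIdeal (𝓞 K)⁰ K))
    (h𝔠 : (𝔠 : FractionalIdeal (𝓞 K)⁰ K) = IdeleAction.ideleMulIdeal c (𝔞 : FractionalIdeal (𝓞 K)⁰ K)) :
    ∃ ξ' : CMTypeUniformization Φ (ideleMulIdealUnits t 𝔞) A' ι',
      (∀ u v : K, (N : K) * u ∈ (𝔞 : FractionalIdeal (𝓞 K)⁰ K) →
        IdeleAction.ideleMulEquiv t (𝔞 : FractionalIdeal (𝓞 K)⁰ K) 𝔞.ne_zero (Submodule.Quotient.mk u) =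
          Submodule.Quotient.mk v →
          F (ξ.r u) = ξ'.r v) ∧
      (∀ w : K, ξ'.r (g * w) = η.r w) ∧ (∀ w : K, ξ'.r w = η.r (g⁻¹ * w)) := by
  have hG1 : ∀ u : K, G (ξ.r u) = η.r (1 * u) := fun u => by rw [one_mul]; exact hG u
  have hF : ∀ u : K, (N : K) * u ∈ (𝔞 : FractionalIdeal (𝓞 K)⁰ K) → F (ξ.r u) = η.r (1 * u) :=
    forall_conj_eq_of_eq_on_torsion ξ η F G (b := 1) hFG hG1
  have h𝔠' : IdeleAction.ideleMulIdeal t (𝔞 : FractionalIdeal (𝓞 K)⁰ K) =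
      spanSingleton (𝓞 K)⁰ (g * (1 : K)⁻¹) * (𝔠 : FractionalIdeal (𝓞 K)⁰ K) := by
    rw [inv_one, mul_one, h𝔠, h3, ← mul_assoc, FractionalIdeal.spanSingleton_mul_spanSingleton,
      mul_inv_cancel₀ hg, FractionalIdeal.spanSingleton_one, one_mul]
  obtain ⟨ξ', h1, h2, h3'⟩ := exists_reindex_forall_conj_eq_of_torsionCongruence_units ξ η F t one_ne_zero hg hF hTT h𝔠'
  refine ⟨ξ', h1, fun w => ?_, fun w => ?_⟩
  · simpa only [inv_one, mul_one] using h2 w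
  · simpa only [inv_one, mul_one] using h3' w

end CMTypeUniformization

end Literature.NumberTheory.ComplexMultiplication

end
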